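import Literature.NumberTheory.LFunctions.NicolasSqrtAverage
import Literature.NumberTheory.LFunctions.NicolasLemma24RH
import HarnessLib

/-!
# Nicolas 2012, Corollary 2.1 (2.13) from the Riemann hypothesis alone, with the printed constants

Topic: `Literature/NumberTheory/LFunctions`. THEOREMS (everything proved, no definition, nothing
asserted). Provefact `Literature.NumberTheory.LFunctions.Nicolas2012_logf_lower_sharp` ((2.18),
`NicolasMertensRH.lean`); this file removes its last named input, the `θ(y) < y` table
`PlattTrudgian2016_theta_lt` (`NicolasPsiTheta.lean`), by proving

* `cor21_upperRH` — **under RH, for every `x > 1`, `J(x) − K(x) ≤ F_{1/2}(x) + (4/3) F_{1/3}(x)`**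
  (Nicolas 2012, Cor. 2.1 (2.13), upper half; `J, K` = `NicolasJ.nicolasJ`, `NicolasK.nicolasKInt`,
  `F_z` = `NicolasFz.Fz`),

WITHOUT Lemma 2.4's pointwise `ψ(t) − θ(t) ≤ √t + (4/3)t^{1/3}` on `[2³², ∞)` (whose Case 2 is the
table). `J − K = lim_X ∫ₓ^X (ψ − θ) w₀` (`NicolasK`); below `2³²` the pointwise bound is the tree's
kernel computation `psi_sub_theta_le_of_lt_two_pow_32` (`PsiThetaSmall.lean`); from `a ≥ 2³²` on
(`core`):

  `∫ₐ^X (ψ − θ) w₀ ≤ ∫ₐ^X √t w₀ + (4/3) F_{1/3}(a) + 2β wt(a) X^{−3/4}`,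

from `ψ − θ ≤ ψ(√t) + ψ(t^{1/3}) + ψ(t^{1/5})` (Mathlib, Costa Pereira), `ψ(√t) = √t + R(√t)` with the
AVERAGED bound for `∫ R(√t) w₀` of the sibling `NicolasSqrtAverage.lean` (explicit formula for `ψ₁`
under RH), `θ(t^{1/3}) ≤ t^{1/3} + t^{1/6} log² t/(72π)` (Schoenfeld (6.3), `Schoenfeld1976_theta_holds`,
computational), `log² t ≤ (24/e)² t^{1/12}`, `ψ − θ ≤ 1.021√y + (4/3)y^{1/3}`
(`Lemma24RH.psi_sub_theta_le`, RH), `θ(y) ≤ y log 4`, the crude `F_c(a) ≤ wt(a) a^{c−1}/(1−c)` and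
the lower bound `F_{1/3}(a) ≥ 3/(2a^{2/3} log a) − 3/(4 a^{2/3} log² a)` ((2.2) with `|r_{1/3}|`
bounded as in (2.3)); the numerical margin at `a = 2³²` is `2.33 < 3.10` in units of
`a^{−3/4}/log a` (`numeric_core`), and `a = 2³²` is the worst case (every excess term decreases in
`a`, the room increases).

Computational dependencies: those of `Schoenfeld1976_theta_holds` (certified zeros, `native_decide`)
and the kernel certificate of `PsiThetaSmall`.

## References

* J.-L. Nicolas, *Small values of the Euler function and the Riemann hypothesis*, Acta Arith. 155
  (2012), 311–321 (arXiv:1202.0729): Lemma 2.2 (2.2)–(2.5), Lemma 2.4 (2.12), Cor. 2.1 (2.13),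
  display (2.18). [Nicolas2012]
* L. Schoenfeld, Math. Comp. 30 (1976), 337–360, Thm. 10 (6.3). [Schoenfeld1976]
-/

noncomputable section

open Filter Set MeasureTheory intervalIntegral
open scoped Real Chebyshev Topology

namespace Literature.NumberTheory.LFunctions

namespace NicolasCor21RH

open NicolasJ NicolasFz NicolasK NicolasJExplicit NicolasSqrtAverage

/-! ### `F_c(a)`: splitting, a crude upper bound, and the lower bound for `F_{1/3}` -/

/-- The real integrand of `F_c` is integrable on `(x, ∞)` (`c < 1`, `x > 1`). [cite: Nicolas2012, (1.17)] -/
theorem integrableOn_rpow_mul_wt {c x : ℝ} (hc : c < 1) (hx : 1 < x) :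
    IntegrableOn (fun t : ℝ ↦ t ^ (c - 2) * wt t) (Ioi x) := by
  have hx0 : 0 < x := by linarith
  have hintC := integrableOn_Fz (z := (c : ℂ)) (x := x) (by simpa using hc) hx
  have h2 : IntegrableOn (fun t : ℝ ↦ (((t ^ (c - 2) * wt t : ℝ)) : ℂ)) (Ioi x) :=
    hintC.congr_fun (fun t ht ↦ integrand_ofReal (hx0.trans ht)) measurableSet_Ioi
  have h3 : Integrable (fun t : ℝ ↦ t ^ (c - 2) * wt t) (volume.restrict (Ioi x)) := by
    simpa using h2.re
  exact h3

/-- `t^{c−2} wt(t) = t^c w₀(t)` (`t > 0`). [folklore] -/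
theorem rpow_mul_wt_eq {c t : ℝ} (ht : 0 < t) : t ^ (c - 2) * wt t = t ^ c * w0 t := by
  rw [Real.rpow_sub ht, Real.rpow_two, w0]; ring

/-- **Splitting `F_c`**: `F_c(x) − F_c(A) = ∫ₓ^A t^c w₀(t) dt` for `1 < x ≤ A`, `c < 1`.
[cite: Nicolas2012, (1.17)] -/
theorem Fz_re_sub {c x A : ℝ} (hc : c < 1) (hx : 1 < x) (hxA : x ≤ A) :
    (Fz c x).re - (Fz c A).re = ∫ t in x..A, t ^ c * w0 t := by
  have hx0 : 0 < x := by linarith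
  have hA : 1 < A := hx.trans_le hxA
  rw [Fz_ofReal hx, Fz_ofReal hA, Complex.ofReal_re, Complex.ofReal_re,
    intervalIntegral.integral_Ioi_sub_Ioi (integrableOn_rpow_mul_wt hc hx) hxA]
  refine intervalIntegral.integral_congr fun t ht ↦ ?_
  rw [uIcc_of_le hxA] at ht
  exact rpow_mul_wt_eq (hx0.trans_le ht.1)

/-- **Crude upper bound**: `F_c(a) ≤ wt(a) a^{c−1}/(1 − c)` for `c < 1`, `a > 1` (`wt` is non-increasing).
[cite: Nicolas2012, Lemma 2.2 (method)] -/
theorem Fz_re_le {c a : ℝ} (hc : c < 1) (ha : 1 < a) :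
    (Fz c a).re ≤ wt a * a ^ (c - 1) / (1 - c) := by
  have ha0 : 0 < a := by linarith
  have hwta : 0 < wt a := by have := Real.log_pos ha; unfold wt; positivity
  rw [Fz_ofReal ha, Complex.ofReal_re]
  have hrpow : IntegrableOn (fun t : ℝ ↦ t ^ (c - 2)) (Ioi a) := integrableOn_Ioi_rpow_of_lt (by linarith) ha0
  calc ∫ t in Ioi a, t ^ (c - 2) * wt t ≤ ∫ t in Ioi a, wt a * t ^ (c - 2) := by
        refine setIntegral_mono_on (integrableOn_rpow_mul_wt hc ha) (hrpow.const_mul _) measurableSet_Ioi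
          fun t ht ↦ ?_
        have ht0 : 0 < t := ha0.trans ht
        rw [mul_comm]
        exact mul_le_mul_of_nonneg_right (wt_le ha ht.le) (Real.rpow_nonneg ht0.le _)
    _ = wt a * (-a ^ (c - 2 + 1) / (c - 2 + 1)) := by
        rw [MeasureTheory.integral_const_mul, integral_Ioi_rpow_of_lt (by linarith) ha0]
    _ = wt a * a ^ (c - 1) / (1 - c) := by
        rw [show c - 2 + 1 = c - 1 by ring]
        have h1 : (1 - c) ≠ 0 := by linarith
        have h2 : (c - 1) ≠ 0 := by linarith
        field_simp
        ring

/-- `∫ₐ^X t^c w₀ ≤ wt(a) a^{c−1}/(1 − c)` (`c < 1`, `1 < a ≤ X`). [cite: Nicolas2012, Lemma 2.2 (method)] -/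
theorem integral_rpow_mul_w0_le {c a X : ℝ} (hc : c < 1) (ha : 1 < a) (haX : a ≤ X) :
    ∫ t in a..X, t ^ c * w0 t ≤ wt a * a ^ (c - 1) / (1 - c) :=
  (integral_rpow_mul_w0_le_Fz hc ha haX).trans (Fz_re_le hc ha)

/-- **Lower bound for `F_{1/3}`**: `F_{1/3}(a) ≥ 3/(2 a^{2/3} log a) − 3/(4 a^{2/3} log² a)` (`a > 1`):
(2.2) with `|r_{1/3}(a)| ≤ (1/2)·a^{−2/3}/((2/3) log² a)`. [cite: Nicolas2012, Lemma 2.2 (2.2), (2.5)] -/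
theorem Fthird_ge {a : ℝ} (ha : 1 < a) :
    3 / (2 * a ^ (2 / 3 : ℝ) * Real.log a) - 3 / (4 * a ^ (2 / 3 : ℝ) * Real.log a ^ 2) ≤
      (Fz (1 / 3 : ℝ) a).re := by
  have ha0 : 0 < a := by linarith
  have hla : 0 < Real.log a := Real.log_pos ha
  have hz : ((1 / 3 : ℝ) : ℂ).re < 1 := by simp; norm_num
  rw [Fz_eq hz ha, Complex.add_re]
  have hmain : ((a : ℂ) ^ (((1 / 3 : ℝ) : ℂ) - 1) / ((1 - ((1 / 3 : ℝ) : ℂ)) * Real.log a)).re =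
      3 / (2 * a ^ (2 / 3 : ℝ) * Real.log a) := by
    rw [show (((1 / 3 : ℝ) : ℂ) - 1) = ((-(2 / 3) : ℝ) : ℂ) by push_cast; norm_num,
      ← Complex.ofReal_cpow ha0.le, show (1 - ((1 / 3 : ℝ) : ℂ)) = ((2 / 3 : ℝ) : ℂ) by push_cast; norm_num]
    rw [show ((a ^ (-(2 / 3) : ℝ) : ℝ) : ℂ) / (((2 / 3 : ℝ) : ℂ) * (Real.log a : ℂ)) =
      ((a ^ (-(2 / 3) : ℝ) / ((2 / 3) * Real.log a) : ℝ) : ℂ) by push_cast; ring, Complex.ofReal_re,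
      Real.rpow_neg ha0.le]
    field_simp
  rw [hmain]
  -- `|r_{1/3}(a)| ≤ 3/(4 a^{2/3} log² a)`
  have hr : ‖rz ((1 / 3 : ℝ) : ℂ) a‖ ≤ 3 / (4 * a ^ (2 / 3 : ℝ) * Real.log a ^ 2) := by
    rw [rz]
    have h := norm_integral_cpow_div_log_pow_le hz ha (-((1 / 3 : ℝ) : ℂ) / (1 - ((1 / 3 : ℝ) : ℂ))) 2
    refine h.trans (le_of_eq ?_)
    have hc : ‖-((1 / 3 : ℝ) : ℂ) / (1 - ((1 / 3 : ℝ) : ℂ))‖ = 1 / 2 := by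
      rw [show -((1 / 3 : ℝ) : ℂ) / (1 - ((1 / 3 : ℝ) : ℂ)) = ((-(1 / 2) : ℝ) : ℂ) by push_cast; norm_num,
        Complex.norm_real]
      norm_num
    rw [hc, show ((1 / 3 : ℝ) : ℂ).re = 1 / 3 by simp, show (1 / 3 - 1 : ℝ) = -(2 / 3) by norm_num,
      Real.rpow_neg ha0.le]
    field_simp
    norm_num
  have hre : -‖rz ((1 / 3 : ℝ) : ℂ) a‖ ≤ (rz ((1 / 3 : ℝ) : ℂ) a).re :=
    (abs_le.1 (Complex.abs_re_le_norm _)).1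
  linarith

/-! ### Numerical constants -/

/-- `c ≤ B^{1/n}` from `cⁿ ≤ B` (`c ≥ 0`, `n ≠ 0`). [folklore] -/
theorem le_rpow_inv_of_pow_le {c B : ℝ} {n : ℕ} (hn : n ≠ 0) (hc : 0 ≤ c) (h : c ^ n ≤ B) :
    c ≤ B ^ ((n : ℝ)⁻¹) := by
  calc c = (c ^ n) ^ ((n : ℝ)⁻¹) := (Real.pow_rpow_inv_natCast hc hn).symm
    _ ≤ B ^ ((n : ℝ)⁻¹) := Real.rpow_le_rpow (pow_nonneg hc n) h (by positivity)

/-- `6.349 ≤ (2³²)^{1/12}` (`6.349¹² ≤ 2³²`). [folklore] -/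
theorem rpow_one_twelfth_ge : (6.349 : ℝ) ≤ ((2 : ℝ) ^ 32) ^ (1 / 12 : ℝ) := by
  rw [show (1 / 12 : ℝ) = ((12 : ℕ) : ℝ)⁻¹ by norm_num]
  exact le_rpow_inv_of_pow_le (by norm_num) (by norm_num) (by norm_num)

/-- `3.03 ≤ (2³²)^{1/20}` (`3.03²⁰ ≤ 2³²`). [folklore] -/
theorem rpow_one_twentieth_ge : (3.03 : ℝ) ≤ ((2 : ℝ) ^ 32) ^ (1 / 20 : ℝ) := by
  rw [show (1 / 20 : ℝ) = ((20 : ℕ) : ℝ)⁻¹ by norm_num]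
  exact le_rpow_inv_of_pow_le (by norm_num) (by norm_num) (by norm_num)

/-- `599 ≤ (2³²)^{1/3}` (`599³ ≤ 2³²`). [folklore] -/
theorem rpow_one_third_ge : (599 : ℝ) ≤ ((2 : ℝ) ^ 32) ^ (1 / 3 : ℝ) := by
  rw [show (1 / 3 : ℝ) = ((3 : ℕ) : ℝ)⁻¹ by norm_num]
  exact le_rpow_inv_of_pow_le (by norm_num) (by norm_num) (by norm_num)

/-- For `a ≥ 2³²`: `a^{−1/12} ≤ 0.15751`. [folklore] -/
theorem rpow_neg_twelfth_le {a : ℝ} (ha : (2 : ℝ) ^ 32 ≤ a) : a ^ (-(1 / 12) : ℝ) ≤ 0.15751 := by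
  have h2 : (0 : ℝ) < (2 : ℝ) ^ 32 := by positivity
  have h1 : a ^ (-(1 / 12) : ℝ) ≤ ((2 : ℝ) ^ 32) ^ (-(1 / 12) : ℝ) :=
    Real.rpow_le_rpow_of_nonpos h2 ha (by norm_num)
  refine h1.trans ?_
  rw [Real.rpow_neg h2.le]
  have h := rpow_one_twelfth_ge
  have h0 : (0 : ℝ) < ((2 : ℝ) ^ 32) ^ (1 / 12 : ℝ) := by positivity
  rw [inv_le_comm₀ h0 (by norm_num)]
  exact le_trans (by norm_num) h

/-- For `a ≥ 2³²`: `a^{−1/20} ≤ 0.33004`. [folklore] -/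
theorem rpow_neg_twentieth_le {a : ℝ} (ha : (2 : ℝ) ^ 32 ≤ a) : a ^ (-(1 / 20) : ℝ) ≤ 0.33004 := by
  have h2 : (0 : ℝ) < (2 : ℝ) ^ 32 := by positivity
  have h1 : a ^ (-(1 / 20) : ℝ) ≤ ((2 : ℝ) ^ 32) ^ (-(1 / 20) : ℝ) :=
    Real.rpow_le_rpow_of_nonpos h2 ha (by norm_num)
  refine h1.trans ?_
  rw [Real.rpow_neg h2.le]
  have h := rpow_one_twentieth_ge
  have h0 : (0 : ℝ) < ((2 : ℝ) ^ 32) ^ (1 / 20 : ℝ) := by positivity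
  rw [inv_le_comm₀ h0 (by norm_num)]
  exact le_trans (by norm_num) h

/-- For `a ≥ 2³²`: `a^{−1/4} ≤ 1/256`. [folklore] -/
theorem rpow_neg_quarter_le {a : ℝ} (ha : (2 : ℝ) ^ 32 ≤ a) : a ^ (-(1 / 4) : ℝ) ≤ 1 / 256 := by
  have h2 : (0 : ℝ) < (2 : ℝ) ^ 32 := by positivity
  have h1 : a ^ (-(1 / 4) : ℝ) ≤ ((2 : ℝ) ^ 32) ^ (-(1 / 4) : ℝ) :=
    Real.rpow_le_rpow_of_nonpos h2 ha (by norm_num)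
  refine h1.trans (le_of_eq ?_)
  rw [show ((2 : ℝ) ^ 32) = (256 : ℝ) ^ (4 : ℝ) by norm_num, ← Real.rpow_mul (by norm_num)]
  norm_num

/-- For `a ≥ 2³²`: `6.349 ≤ a^{1/12}`. [folklore] -/
theorem rpow_twelfth_ge {a : ℝ} (ha : (2 : ℝ) ^ 32 ≤ a) : (6.349 : ℝ) ≤ a ^ (1 / 12 : ℝ) :=
  rpow_one_twelfth_ge.trans (Real.rpow_le_rpow (by positivity) ha (by norm_num))

/-- For `a ≥ 2³²`: `22.18 ≤ log a`. [folklore] -/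
theorem log_ge {a : ℝ} (ha : (2 : ℝ) ^ 32 ≤ a) : (22.18 : ℝ) ≤ Real.log a :=
  Lemma24RH.log_two_pow_32_ge.trans (Real.log_le_log (by positivity) ha)

/-- `log(2π) < 1.8391`. [folklore] -/
theorem log_two_pi_lt : Real.log (2 * π) < 1.8391 := by
  rw [Real.log_mul (by norm_num) Real.pi_pos.ne']
  have := Real.log_two_lt_d9
  have := log_pi_lt
  linarith

/-- `log 4 < 1.3863`. [folklore] -/
theorem log_four_lt : Real.log 4 < 1.3863 := by
  rw [show (4 : ℝ) = 2 ^ 2 by norm_num, Real.log_pow]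
  have := Real.log_two_lt_d9
  push_cast
  linarith

/-- **`log² t ≤ (576/e²) t^{1/12}`** for `t ≥ 1` (`log t = 24 log t^{1/24} ≤ 24 t^{1/24}/e`; this is
Nicolas's (1.21) with `a = 2`, `b = 1/12`). [cite: Nicolas2012, (1.21)] -/
theorem log_sq_le {t : ℝ} (ht : 1 ≤ t) :
    Real.log t ^ 2 ≤ 576 / Real.exp 1 ^ 2 * t ^ (1 / 12 : ℝ) := by
  have ht0 : 0 < t := by linarith
  have he : 0 < Real.exp 1 := Real.exp_pos 1
  have hu : 0 < t ^ (1 / 24 : ℝ) := Real.rpow_pos_of_pos ht0 _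
  have h1 : Real.log t = 24 * Real.log (t ^ (1 / 24 : ℝ)) := by
    rw [Real.log_rpow ht0]; ring
  -- `log u ≤ u/e` (`u > 0`), from `log(u/e) ≤ u/e − 1`
  have h2 : Real.log (t ^ (1 / 24 : ℝ)) ≤ t ^ (1 / 24 : ℝ) / Real.exp 1 := by
    have h := Real.log_le_sub_one_of_pos (div_pos hu he)
    rw [Real.log_div hu.ne' he.ne', Real.log_exp] at h
    linarith
  have h3 : 0 ≤ Real.log t := Real.log_nonneg ht
  have h4 : Real.log t ≤ 24 * (t ^ (1 / 24 : ℝ) / Real.exp 1) := by rw [h1]; linarith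
  have h5 : (t ^ (1 / 24 : ℝ)) ^ 2 = t ^ (1 / 12 : ℝ) := by
    rw [← Real.rpow_natCast, ← Real.rpow_mul ht0.le]; norm_num
  calc Real.log t ^ 2 ≤ (24 * (t ^ (1 / 24 : ℝ) / Real.exp 1)) ^ 2 := pow_le_pow_left₀ h3 h4 2
    _ = 576 / Real.exp 1 ^ 2 * (t ^ (1 / 24 : ℝ)) ^ 2 := by field_simp; ring
    _ = 576 / Real.exp 1 ^ 2 * t ^ (1 / 12 : ℝ) := by rw [h5]

/-- `576/(72 π e²) ≤ 0.3447`. [folklore] -/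
theorem schoenfeld_coeff_le : 576 / Real.exp 1 ^ 2 / (72 * π) ≤ 0.3447 := by
  have he := Real.exp_one_gt_d9
  have hπ := Real.pi_gt_d6
  have he2 : (7.389056 : ℝ) ≤ Real.exp 1 ^ 2 := by nlinarith
  rw [div_div, div_le_iff₀ (by positivity)]
  nlinarith

/-! ### The pointwise bound for `ψ − θ` on `[2³², ∞)` with `ψ(√t)` kept -/

/-- **Schoenfeld at the cube root**: under RH, for `t ≥ 2³²`,
`θ(t^{1/3}) ≤ t^{1/3} + 0.3447 t^{1/4}` (`|θ(y) − y| ≤ √y log² y/(8π)` at `y = t^{1/3} ≥ 1625`, and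
`t^{1/6} log² t/(72π) ≤ 0.3447 t^{1/4}`). [cite: Schoenfeld1976, Thm. 10 (6.3)] -/
theorem theta_cbrt_le (hRH : RiemannHypothesis) {t : ℝ} (ht : (2 : ℝ) ^ 32 ≤ t) :
    θ (t ^ (1 / 3 : ℝ)) ≤ t ^ (1 / 3 : ℝ) + 0.3447 * t ^ (1 / 4 : ℝ) := by
  have h2 : (0 : ℝ) < (2 : ℝ) ^ 32 := by positivity
  have ht0 : 0 < t := h2.trans_le ht
  have ht1 : 1 ≤ t := le_trans (by norm_num) ht
  have hy : (599 : ℝ) ≤ t ^ (1 / 3 : ℝ) :=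
    rpow_one_third_ge.trans (Real.rpow_le_rpow h2.le ht (by norm_num))
  have hS := Schoenfeld1976_theta_holds hRH (t ^ (1 / 3 : ℝ)) hy
  have hsqrt : Real.sqrt (t ^ (1 / 3 : ℝ)) = t ^ (1 / 6 : ℝ) := by
    rw [Real.sqrt_eq_rpow, ← Real.rpow_mul ht0.le]; norm_num
  have hlog : Real.log (t ^ (1 / 3 : ℝ)) = 1 / 3 * Real.log t := Real.log_rpow ht0 _
  rw [hsqrt, hlog] at hS
  have h1 := (abs_le.1 hS).2
  -- `t^{1/6} (log t/3)²/(8π) ≤ 0.3447 t^{1/4}`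
  have hL := log_sq_le ht1
  have h16 : 0 ≤ t ^ (1 / 6 : ℝ) := Real.rpow_nonneg ht0.le _
  have h14 : t ^ (1 / 6 : ℝ) * t ^ (1 / 12 : ℝ) = t ^ (1 / 4 : ℝ) := by
    rw [← Real.rpow_add ht0]; norm_num
  have hc := schoenfeld_coeff_le
  have hπ : 0 < π := Real.pi_pos
  have he : 0 < Real.exp 1 ^ 2 := by positivity
  have key : t ^ (1 / 6 : ℝ) * (1 / 3 * Real.log t) ^ 2 / (8 * π) ≤ 0.3447 * t ^ (1 / 4 : ℝ) := by
    have e1 : t ^ (1 / 6 : ℝ) * (1 / 3 * Real.log t) ^ 2 / (8 * π) =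
        t ^ (1 / 6 : ℝ) * Real.log t ^ 2 / (72 * π) := by
      field_simp; ring
    rw [e1]
    calc t ^ (1 / 6 : ℝ) * Real.log t ^ 2 / (72 * π)
        ≤ t ^ (1 / 6 : ℝ) * (576 / Real.exp 1 ^ 2 * t ^ (1 / 12 : ℝ)) / (72 * π) := by
          gcongr
      _ = 576 / Real.exp 1 ^ 2 / (72 * π) * (t ^ (1 / 6 : ℝ) * t ^ (1 / 12 : ℝ)) := by
          field_simp
      _ ≤ 0.3447 * t ^ (1 / 4 : ℝ) := by
          rw [h14]
          exact mul_le_mul_of_nonneg_right hc (Real.rpow_nonneg ht0.le _)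
  linarith

/-- Under RH, `ψ(y) − θ(y) ≤ 2.3544 √y` for `y ≥ 1` (`Lemma24RH.psi_sub_theta_le` and `y^{1/3} ≤ √y`).
[cite: Nicolas2012, Lemma 2.4 (2.12) (weakened, RH-only form of the tree)] -/
theorem psi_sub_theta_le_sqrt (hRH : RiemannHypothesis) {y : ℝ} (hy : 1 ≤ y) :
    ψ y - θ y ≤ 2.3544 * Real.sqrt y := by
  have h := Lemma24RH.psi_sub_theta_le hRH hy
  have h13 : y ^ ((1 : ℝ) / 3) ≤ Real.sqrt y := by
    rw [Real.sqrt_eq_rpow]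
    exact Real.rpow_le_rpow_of_exponent_le hy (by norm_num)
  have hs : 0 ≤ Real.sqrt y := Real.sqrt_nonneg y
  linarith

/-- **The pointwise input on `[2³², ∞)`** (replacing Lemma 2.4 there): under RH, for `t ≥ 2³²`,
`ψ(t) − θ(t) ≤ √t + (ψ(√t) − √t) + t^{1/3} + 0.3447 t^{1/4} + 1.3863 t^{1/5} + 4.7088 t^{1/6}`
(`ψ − θ ≤ ψ(√t) + ψ(t^{1/3}) + ψ(t^{1/5})`, Costa Pereira / Mathlib; Schoenfeld at `t^{1/3}`;
`ψ − θ ≤ 2.3544 √y` at `y = t^{1/3}, t^{1/5}`; `θ(y) ≤ y log 4`).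
[cite: Nicolas2012, Lemma 2.4 (2.12) (our replacement on `[2³², ∞)`)] -/
theorem psi_sub_theta_le_keep_sqrt (hRH : RiemannHypothesis) {t : ℝ} (ht : (2 : ℝ) ^ 32 ≤ t) :
    ψ t - θ t ≤ t ^ (1 / 2 : ℝ) + (ψ (Real.sqrt t) - Real.sqrt t) + t ^ (1 / 3 : ℝ) +
      0.3447 * t ^ (1 / 4 : ℝ) + 1.3863 * t ^ (1 / 5 : ℝ) + 4.7088 * t ^ (1 / 6 : ℝ) := by
  have h2 : (0 : ℝ) < (2 : ℝ) ^ 32 := by positivity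
  have ht0 : 0 < t := h2.trans_le ht
  have ht1 : 1 ≤ t := le_trans (by norm_num) ht
  -- Costa Pereira
  have hCP := Chebyshev.psi_sub_theta_le_psi_add_psi_add_psi t
  rw [show (2 : ℝ)⁻¹ = 1 / 2 by norm_num, show (3 : ℝ)⁻¹ = 1 / 3 by norm_num,
    show (5 : ℝ)⁻¹ = 1 / 5 by norm_num, ← Real.sqrt_eq_rpow] at hCP
  -- the pieces
  have hy3 : 1 ≤ t ^ (1 / 3 : ℝ) := Real.one_le_rpow ht1 (by norm_num)
  have hy5 : 1 ≤ t ^ (1 / 5 : ℝ) := Real.one_le_rpow ht1 (by norm_num)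
  have hθ3 := theta_cbrt_le hRH ht
  have hψθ3 := psi_sub_theta_le_sqrt hRH hy3
  have hψθ5 := psi_sub_theta_le_sqrt hRH hy5
  have hθ5 : θ (t ^ (1 / 5 : ℝ)) ≤ 1.3863 * t ^ (1 / 5 : ℝ) := by
    have h := Chebyshev.theta_le_log4_mul_x (Real.rpow_nonneg ht0.le (1 / 5 : ℝ))
    have hl := log_four_lt
    have h0 : 0 ≤ t ^ (1 / 5 : ℝ) := Real.rpow_nonneg ht0.le _
    nlinarith
  have hs3 : Real.sqrt (t ^ (1 / 3 : ℝ)) = t ^ (1 / 6 : ℝ) := by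
    rw [Real.sqrt_eq_rpow, ← Real.rpow_mul ht0.le]; norm_num
  have hs5 : Real.sqrt (t ^ (1 / 5 : ℝ)) ≤ t ^ (1 / 6 : ℝ) := by
    rw [Real.sqrt_eq_rpow, ← Real.rpow_mul ht0.le]
    exact Real.rpow_le_rpow_of_exponent_le ht1 (by norm_num)
  rw [hs3] at hψθ3
  have hsq : Real.sqrt t = t ^ (1 / 2 : ℝ) := Real.sqrt_eq_rpow t
  nlinarith [hCP, hθ3, hψθ3, hψθ5, hθ5, hs5, hsq]

/-! ### The numerical heart: the excess fits inside `(1/3) F_{1/3}(a)` for `a ≥ 2³²` -/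

/-- **Numerics at and beyond `2³²`**: for `a ≥ 2³²` the `a`-terms of the averaged square-root bound
plus the three `F`-type excess terms are at most the lower bound for `(1/3) F_{1/3}(a)`; in units of
`a^{−3/4}/log a` the two sides are `≤ 2.33` and `≥ 3.10`. [cite: Nicolas2012, (2.18) (numerical margin of our route)] -/
theorem numeric_core {a : ℝ} (ha : (2 : ℝ) ^ 32 ≤ a) :
    2 * nicolasBeta * wt a * a ^ (-(3 / 4) : ℝ)
      + 4 / 3 * nicolasBeta * (3 / Real.log a + 5 / Real.log a ^ 2 + 4 / Real.log a ^ 3) * a ^ (-(3 / 4) : ℝ)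
      + 2 * Real.log (2 * π) * wt a * a⁻¹ + wt a * (a⁻¹ / (a - 1))
      + 0.3447 * (wt a * a ^ ((1 / 4 : ℝ) - 1) / (1 - 1 / 4))
      + 1.3863 * (wt a * a ^ ((1 / 5 : ℝ) - 1) / (1 - 1 / 5))
      + 4.7088 * (wt a * a ^ ((1 / 6 : ℝ) - 1) / (1 - 1 / 6))
    ≤ 1 / 3 * (3 / (2 * a ^ (2 / 3 : ℝ) * Real.log a) - 3 / (4 * a ^ (2 / 3 : ℝ) * Real.log a ^ 2)) := by
  have h2 : (0 : ℝ) < (2 : ℝ) ^ 32 := by positivity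
  have ha0 : 0 < a := h2.trans_le ha
  have ha1 : (2 : ℝ) ^ 32 - 1 ≤ a - 1 := by linarith
  -- atoms
  set p : ℝ := a ^ (-(3 / 4) : ℝ) with hp
  set q : ℝ := a ^ (-(1 / 4) : ℝ) with hq
  set r : ℝ := a ^ (-(1 / 12) : ℝ) with hr
  set s : ℝ := a ^ (-(1 / 20) : ℝ) with hs
  set m : ℝ := a ^ (1 / 12 : ℝ) with hm
  set v : ℝ := (Real.log a)⁻¹ with hv
  have hp0 : 0 < p := Real.rpow_pos_of_pos ha0 _
  have hq0 : 0 < q := Real.rpow_pos_of_pos ha0 _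
  have hr0 : 0 < r := Real.rpow_pos_of_pos ha0 _
  have hs0 : 0 < s := Real.rpow_pos_of_pos ha0 _
  have hlog : (22.18 : ℝ) ≤ Real.log a := log_ge ha
  have hlog0 : 0 < Real.log a := by linarith
  have hv0 : 0 < v := inv_pos.2 hlog0
  have hv1 : v ≤ 1 / 22.18 := by rw [hv, inv_eq_one_div]; exact one_div_le_one_div_of_le (by norm_num) hlog
  have hqb : q ≤ 1 / 256 := rpow_neg_quarter_le ha
  have hrb : r ≤ 0.15751 := rpow_neg_twelfth_le ha
  have hsb : s ≤ 0.33004 := rpow_neg_twentieth_le ha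
  have hmb : (6.349 : ℝ) ≤ m := rpow_twelfth_ge ha
  have hβ0 : 0 < nicolasBeta := lt_trans (by norm_num) nicolasBeta_gt
  have hβ1 : nicolasBeta ≤ 0.0474 := nicolasBeta_lt'.le
  have hL0 : 0 ≤ Real.log (2 * π) := Real.log_nonneg (by linarith [Real.pi_gt_three])
  have hL1 : Real.log (2 * π) ≤ 1.8391 := log_two_pi_lt.le
  have hd0 : 0 < (a - 1)⁻¹ := inv_pos.2 (by linarith)
  have hd1 : (a - 1)⁻¹ ≤ 1 / ((2 : ℝ) ^ 32 - 1) := by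
    rw [inv_eq_one_div]; exact one_div_le_one_div_of_le (by norm_num) ha1
  -- rewrite every power through the atoms
  have e_wt : wt a = v + v ^ 2 := by simp only [wt, hv, one_div, inv_pow]
  have e4 : a ^ ((1 / 4 : ℝ) - 1) = p := by rw [hp]; norm_num
  have e5 : a ^ ((1 / 5 : ℝ) - 1) = p * s := by rw [hp, hs, ← Real.rpow_add ha0]; norm_num
  have e6 : a ^ ((1 / 6 : ℝ) - 1) = p * r := by rw [hp, hr, ← Real.rpow_add ha0]; norm_num
  have e1 : a⁻¹ = p * q := by rw [hp, hq, ← Real.rpow_add ha0, ← Real.rpow_neg_one]; norm_num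
  have e23 : (a ^ (2 / 3 : ℝ))⁻¹ = p * m := by
    rw [hp, hm, ← Real.rpow_add ha0, ← Real.rpow_neg ha0.le]; norm_num
  have hlogv : Real.log a = v⁻¹ := by rw [hv, inv_inv]
  have e23' : a ^ (2 / 3 : ℝ) = (p * m)⁻¹ := by rw [← e23, inv_inv]
  have hlogv : Real.log a = v⁻¹ := by rw [hv, inv_inv]
  have hpm : p * m ≠ 0 := by positivity
  -- the excess per unit `p·v`, bounded by its value at the numerical bounds of the atoms
  have hΦ : 2 * nicolasBeta * (1 + v) + 4 / 3 * nicolasBeta * (3 + 5 * v + 4 * v ^ 2)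
      + 2 * Real.log (2 * π) * (1 + v) * q + (1 + v) * (q * (a - 1)⁻¹)
      + 0.3447 * ((1 + v) / (1 - 1 / 4)) + 1.3863 * ((1 + v) * s / (1 - 1 / 5))
      + 4.7088 * ((1 + v) * r / (1 - 1 / 6))
      ≤ 2 * 0.0474 * (1 + 1 / 22.18) + 4 / 3 * 0.0474 * (3 + 5 * (1 / 22.18) + 4 * (1 / 22.18) ^ 2)
        + 2 * 1.8391 * (1 + 1 / 22.18) * (1 / 256) + (1 + 1 / 22.18) * (1 / 256 * (1 / ((2 : ℝ) ^ 32 - 1)))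
        + 0.3447 * ((1 + 1 / 22.18) / (1 - 1 / 4)) + 1.3863 * ((1 + 1 / 22.18) * 0.33004 / (1 - 1 / 5))
        + 4.7088 * ((1 + 1 / 22.18) * 0.15751 / (1 - 1 / 6)) := by
    gcongr
  have hnum : 2 * 0.0474 * (1 + 1 / 22.18) + 4 / 3 * 0.0474 * (3 + 5 * (1 / 22.18) + 4 * (1 / 22.18) ^ 2)
        + 2 * 1.8391 * (1 + 1 / 22.18) * (1 / 256) + (1 + 1 / 22.18) * (1 / 256 * (1 / ((2 : ℝ) ^ 32 - 1)))
        + 0.3447 * ((1 + 1 / 22.18) / (1 - 1 / 4)) + 1.3863 * ((1 + 1 / 22.18) * 0.33004 / (1 - 1 / 5))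
        + 4.7088 * ((1 + 1 / 22.18) * 0.15751 / (1 - 1 / 6)) ≤ (2.33 : ℝ) := by
    norm_num
  -- the room per unit `p·v`
  have hw : (0.488728 : ℝ) ≤ 1 / 2 - v / 4 := by linarith
  have hΨ : (3.10 : ℝ) ≤ m * (1 / 2 - v / 4) := by
    have h := mul_le_mul hmb hw (by norm_num) (by linarith)
    exact le_trans (by norm_num) h
  have hkey : 2 * nicolasBeta * (1 + v) + 4 / 3 * nicolasBeta * (3 + 5 * v + 4 * v ^ 2)
      + 2 * Real.log (2 * π) * (1 + v) * q + (1 + v) * (q * (a - 1)⁻¹)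
      + 0.3447 * ((1 + v) / (1 - 1 / 4)) + 1.3863 * ((1 + v) * s / (1 - 1 / 5))
      + 4.7088 * ((1 + v) * r / (1 - 1 / 6)) ≤ m * (1 / 2 - v / 4) := by
    linarith
  have hpv : 0 ≤ p * v := by positivity
  have hmain := mul_le_mul_of_nonneg_left hkey hpv
  -- back to the original quantities
  have ha1' : a - 1 ≠ 0 := by linarith
  have hv0' : v ≠ 0 := hv0.ne'
  calc _ = p * v * (2 * nicolasBeta * (1 + v) + 4 / 3 * nicolasBeta * (3 + 5 * v + 4 * v ^ 2)
        + 2 * Real.log (2 * π) * (1 + v) * q + (1 + v) * (q * (a - 1)⁻¹)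
        + 0.3447 * ((1 + v) / (1 - 1 / 4)) + 1.3863 * ((1 + v) * s / (1 - 1 / 5))
        + 4.7088 * ((1 + v) * r / (1 - 1 / 6))) := by
          rw [e4, e5, e6, e1]
          unfold wt
          rw [hlogv]
          field_simp
    _ ≤ p * v * (m * (1 / 2 - v / 4)) := hmain
    _ = _ := by
          rw [e23', hlogv]
          field_simp

/-! ### The core estimate on `[a, X]`, `a ≥ 2³²` -/

/-- `(ψ(√t) − √t) w₀(t)` is interval integrable on `[a, X] ⊂ (1, ∞)`. [folklore] -/
theorem intervalIntegrable_R_sqrt_mul_w0 {a X : ℝ} (ha : 1 < a) (haX : a ≤ X) :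
    IntervalIntegrable (fun t : ℝ ↦ (ψ (Real.sqrt t) - Real.sqrt t) * w0 t) volume a X := by
  have hw0c : ContinuousOn w0 (uIcc a X) := by
    rw [uIcc_of_le haX]; exact continuousOn_w0.mono fun t ht ↦ ha.trans_le ht.1
  exact (monotone_psi_sqrt.intervalIntegrable.sub (Real.continuous_sqrt.intervalIntegrable _ _)).mul_continuousOn
    hw0c

/-- `(ψ(t) − θ(t)) w₀(t)` is interval integrable on `[a, X] ⊂ (1, ∞)`. [folklore] -/
theorem intervalIntegrable_psi_sub_theta_mul_w0 {a X : ℝ} (ha : 1 < a) (haX : a ≤ X) :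
    IntervalIntegrable (fun t : ℝ ↦ (ψ t - θ t) * w0 t) volume a X := by
  have hw0c : ContinuousOn w0 (uIcc a X) := by
    rw [uIcc_of_le haX]; exact continuousOn_w0.mono fun t ht ↦ ha.trans_le ht.1
  exact ((intervalIntegrable_psi a X).sub Chebyshev.theta_mono.intervalIntegrable).mul_continuousOn hw0c

/-- **The core estimate**: under RH, for `2³² ≤ a ≤ X`,
`∫ₐ^X (ψ − θ) w₀ ≤ ∫ₐ^X √t w₀ + (4/3) F_{1/3}(a) + 2β wt(a) X^{−3/4}` (the pointwise input
`psi_sub_theta_le_keep_sqrt`, the averaged square-root term `NicolasSqrtAverage.integral_R_sqrt_mul_w0_le`,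
the `F`-bounds and `numeric_core`). [cite: Nicolas2012, Cor. 2.1 (2.13) (our route on `[2³², ∞)`)] -/
theorem core (hRH : RiemannHypothesis) {a X : ℝ} (ha : (2 : ℝ) ^ 32 ≤ a) (haX : a ≤ X) :
    ∫ t in a..X, (ψ t - θ t) * w0 t ≤
      (∫ t in a..X, t ^ (1 / 2 : ℝ) * w0 t) + 4 / 3 * (Fz (1 / 3 : ℝ) a).re +
        2 * nicolasBeta * wt a * X ^ (-(3 / 4) : ℝ) := by
  have ha1 : 1 < a := lt_of_lt_of_le (by norm_num) ha
  have hIcc : uIcc a X = Icc a X := uIcc_of_le haX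
  -- integrability of the pieces
  have hiL := intervalIntegrable_psi_sub_theta_mul_w0 ha1 haX
  have hi2 := intervalIntegrable_rpow_mul_w0 (1 / 2) ha1 haX
  have hiR := intervalIntegrable_R_sqrt_mul_w0 ha1 haX
  have hi3 := intervalIntegrable_rpow_mul_w0 (1 / 3) ha1 haX
  have hi4 := (intervalIntegrable_rpow_mul_w0 (1 / 4) ha1 haX).const_mul (0.3447 : ℝ)
  have hi5 := (intervalIntegrable_rpow_mul_w0 (1 / 5) ha1 haX).const_mul (1.3863 : ℝ)
  have hi6 := (intervalIntegrable_rpow_mul_w0 (1 / 6) ha1 haX).const_mul (4.7088 : ℝ)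
  have h12 : IntervalIntegrable (fun t : ℝ ↦ t ^ (1 / 2 : ℝ) * w0 t + (ψ (Real.sqrt t) - Real.sqrt t) * w0 t)
      volume a X := hi2.add hiR
  have h123 : IntervalIntegrable (fun t : ℝ ↦ t ^ (1 / 2 : ℝ) * w0 t + (ψ (Real.sqrt t) - Real.sqrt t) * w0 t +
      t ^ (1 / 3 : ℝ) * w0 t) volume a X := h12.add hi3
  have h1234 : IntervalIntegrable (fun t : ℝ ↦ t ^ (1 / 2 : ℝ) * w0 t + (ψ (Real.sqrt t) - Real.sqrt t) * w0 t +
      t ^ (1 / 3 : ℝ) * w0 t + 0.3447 * (t ^ (1 / 4 : ℝ) * w0 t)) volume a X := h123.add hi4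
  have h12345 : IntervalIntegrable (fun t : ℝ ↦ t ^ (1 / 2 : ℝ) * w0 t + (ψ (Real.sqrt t) - Real.sqrt t) * w0 t +
      t ^ (1 / 3 : ℝ) * w0 t + 0.3447 * (t ^ (1 / 4 : ℝ) * w0 t) + 1.3863 * (t ^ (1 / 5 : ℝ) * w0 t)) volume a X :=
    h1234.add hi5
  have h123456 : IntervalIntegrable (fun t : ℝ ↦ t ^ (1 / 2 : ℝ) * w0 t + (ψ (Real.sqrt t) - Real.sqrt t) * w0 t +
      t ^ (1 / 3 : ℝ) * w0 t + 0.3447 * (t ^ (1 / 4 : ℝ) * w0 t) + 1.3863 * (t ^ (1 / 5 : ℝ) * w0 t) +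
      4.7088 * (t ^ (1 / 6 : ℝ) * w0 t)) volume a X := h12345.add hi6
  -- the pointwise bound, integrated
  have hmono : ∫ t in a..X, (ψ t - θ t) * w0 t ≤ ∫ t in a..X,
      (t ^ (1 / 2 : ℝ) * w0 t + (ψ (Real.sqrt t) - Real.sqrt t) * w0 t + t ^ (1 / 3 : ℝ) * w0 t +
        0.3447 * (t ^ (1 / 4 : ℝ) * w0 t) + 1.3863 * (t ^ (1 / 5 : ℝ) * w0 t) +
        4.7088 * (t ^ (1 / 6 : ℝ) * w0 t)) := by
    refine intervalIntegral.integral_mono_on haX hiL h123456 fun t ht ↦ ?_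
    have hpt := psi_sub_theta_le_keep_sqrt hRH (ha.trans ht.1)
    have hw := (w0_pos (ha1.trans_le ht.1)).le
    have h := mul_le_mul_of_nonneg_right hpt hw
    have e : (t ^ (1 / 2 : ℝ) + (ψ (Real.sqrt t) - Real.sqrt t) + t ^ (1 / 3 : ℝ) + 0.3447 * t ^ (1 / 4 : ℝ) +
        1.3863 * t ^ (1 / 5 : ℝ) + 4.7088 * t ^ (1 / 6 : ℝ)) * w0 t =
        t ^ (1 / 2 : ℝ) * w0 t + (ψ (Real.sqrt t) - Real.sqrt t) * w0 t + t ^ (1 / 3 : ℝ) * w0 t +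
        0.3447 * (t ^ (1 / 4 : ℝ) * w0 t) + 1.3863 * (t ^ (1 / 5 : ℝ) * w0 t) +
        4.7088 * (t ^ (1 / 6 : ℝ) * w0 t) := by ring
    rw [e] at h
    exact h
  rw [intervalIntegral.integral_add h12345 hi6, intervalIntegral.integral_add h1234 hi5,
    intervalIntegral.integral_add h123 hi4, intervalIntegral.integral_add h12 hi3,
    intervalIntegral.integral_add hi2 hiR, intervalIntegral.integral_const_mul,
    intervalIntegral.integral_const_mul, intervalIntegral.integral_const_mul] at hmono
  -- the bounds for the pieces
  have hD := integral_R_sqrt_mul_w0_le hRH ha1 haX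
  have hF3 : ∫ t in a..X, t ^ (1 / 3 : ℝ) * w0 t ≤ (Fz (1 / 3 : ℝ) a).re :=
    integral_rpow_mul_w0_le_Fz (by norm_num) ha1 haX
  have hF4 : ∫ t in a..X, t ^ (1 / 4 : ℝ) * w0 t ≤ wt a * a ^ ((1 / 4 : ℝ) - 1) / (1 - 1 / 4) :=
    integral_rpow_mul_w0_le (by norm_num) ha1 haX
  have hF5 : ∫ t in a..X, t ^ (1 / 5 : ℝ) * w0 t ≤ wt a * a ^ ((1 / 5 : ℝ) - 1) / (1 - 1 / 5) :=
    integral_rpow_mul_w0_le (by norm_num) ha1 haX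
  have hF6 : ∫ t in a..X, t ^ (1 / 6 : ℝ) * w0 t ≤ wt a * a ^ ((1 / 6 : ℝ) - 1) / (1 - 1 / 6) :=
    integral_rpow_mul_w0_le (by norm_num) ha1 haX
  have hnum := numeric_core ha
  have hF3ge := Fthird_ge ha1
  nlinarith [hmono, hD, hF3, hF4, hF5, hF6, hnum, hF3ge]

/-! ### Corollary 2.1 under RH -/

/-- **Nicolas 2012, Cor. 2.1 (2.13), upper half, from RH alone and with the printed constants**: under
the Riemann hypothesis, for every `x > 1`, `J(x) − K(x) ≤ F_{1/2}(x) + (4/3) F_{1/3}(x)`. Below `2³²`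
the pointwise Lemma 2.4 is the kernel computation `psi_sub_theta_le_of_lt_two_pow_32`; beyond, `core`.
[cite: Nicolas2012, Cor. 2.1 (2.13)] -/
theorem cor21_upperRH (hRH : RiemannHypothesis) {x : ℝ} (hx : 1 < x) :
    nicolasJ x - nicolasKInt x ≤ (Fz (1 / 2 : ℝ) x).re + 4 / 3 * (Fz (1 / 3 : ℝ) x).re := by
  have hx0 : 0 < x := by linarith
  obtain ⟨C, hC⟩ := exists_abs_Rone_le_of_RH hRH
  have hR : ∀ t, x ≤ t → |Rone t| ≤ C * t ^ (3 / 2 : ℝ) := fun t ht ↦ hC t (by linarith)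
  have hlim := (tendsto_integral_R_mul_w0 hx hR).sub (tendsto_integral_S_mul_w0 hx)
  have hlim' : Tendsto (fun X : ℝ ↦ ∫ t in x..X, (ψ t - θ t) * w0 t) atTop
      (𝓝 (nicolasJ x - nicolasKInt x)) := by
    refine hlim.congr' ?_
    filter_upwards [eventually_ge_atTop x] with X hX
    rw [← intervalIntegral.integral_sub (intervalIntegrable_R_mul_w0 hx hX) (intervalIntegrable_S_mul_w0 hx hX)]
    exact intervalIntegral.integral_congr fun t _ ↦ by ring
  -- the threshold `A = max(x, 2³²)` and the vanishing term `K X^{-3/4}`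
  set B : ℝ := (2 : ℝ) ^ 32 with hB
  have hB1 : (1 : ℝ) < B := by rw [hB]; norm_num
  set A : ℝ := max x B with hA
  set K : ℝ := 2 * nicolasBeta * wt A with hK
  have hbound : ∀ᶠ X : ℝ in atTop, ∫ t in x..X, (ψ t - θ t) * w0 t ≤
      (Fz (1 / 2 : ℝ) x).re + 4 / 3 * (Fz (1 / 3 : ℝ) x).re + K * X ^ (-(3 / 4) : ℝ) := by
    filter_upwards [eventually_ge_atTop A] with X hX
    have hxX : x ≤ X := (le_max_left x B).trans hX
    have hBX : B ≤ X := (le_max_right x B).trans hX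
    rcases le_or_gt B x with h32 | h32
    · -- `x ≥ 2³²`: the core at `a = x`
      have hAx : A = x := max_eq_left h32
      have hcore := core hRH h32 hxX
      have hF2 : ∫ t in x..X, t ^ (1 / 2 : ℝ) * w0 t ≤ (Fz (1 / 2 : ℝ) x).re :=
        integral_rpow_mul_w0_le_Fz (by norm_num) hx hxX
      rw [hK, hAx]
      linarith
    · -- `x < 2³²`: split at `2³²`
      have hAB : A = B := max_eq_right h32.le
      have hxB : x ≤ B := h32.le
      have hi1 := intervalIntegrable_psi_sub_theta_mul_w0 hx hxB
      have hi2 := intervalIntegrable_psi_sub_theta_mul_w0 hB1 hBX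
      rw [← intervalIntegral.integral_add_adjacent_intervals hi1 hi2]
      -- below `2³²`: the kernel computation, pointwise on `(x, 2³²)`
      have hj2 := intervalIntegrable_rpow_mul_w0 (1 / 2) hx hxB
      have hj3 := (intervalIntegrable_rpow_mul_w0 (1 / 3) hx hxB).const_mul (4 / 3 : ℝ)
      have hj23 : IntervalIntegrable (fun t : ℝ ↦ t ^ (1 / 2 : ℝ) * w0 t + 4 / 3 * (t ^ (1 / 3 : ℝ) * w0 t))
          volume x B := hj2.add hj3
      have hlow : ∫ t in x..B, (ψ t - θ t) * w0 t ≤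
          ∫ t in x..B, (t ^ (1 / 2 : ℝ) * w0 t + 4 / 3 * (t ^ (1 / 3 : ℝ) * w0 t)) := by
        refine intervalIntegral.integral_mono_on_of_le_Ioo hxB hi1 hj23 fun t ht ↦ ?_
        have ht1 : 1 < t := hx.trans ht.1
        have hpt := psi_sub_theta_le_of_lt_two_pow_32 ht1.le ht.2
        rw [Real.sqrt_eq_rpow] at hpt
        have hw := (w0_pos ht1).le
        have h := mul_le_mul_of_nonneg_right hpt hw
        have e : (t ^ (1 / 2 : ℝ) + 4 / 3 * t ^ ((1 : ℝ) / 3)) * w0 t =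
            t ^ (1 / 2 : ℝ) * w0 t + 4 / 3 * (t ^ (1 / 3 : ℝ) * w0 t) := by ring
        rw [e] at h
        exact h
      rw [intervalIntegral.integral_add hj2 hj3, intervalIntegral.integral_const_mul] at hlow
      -- beyond `2³²`: the core at `a = 2³²`
      have hcore := core hRH le_rfl hBX
      -- recombine
      have hk2 := intervalIntegrable_rpow_mul_w0 (1 / 2) hB1 hBX
      have hsum : (∫ t in x..B, t ^ (1 / 2 : ℝ) * w0 t) + ∫ t in B..X, t ^ (1 / 2 : ℝ) * w0 t =
          ∫ t in x..X, t ^ (1 / 2 : ℝ) * w0 t := intervalIntegral.integral_add_adjacent_intervals hj2 hk2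
      have hF2 : ∫ t in x..X, t ^ (1 / 2 : ℝ) * w0 t ≤ (Fz (1 / 2 : ℝ) x).re :=
        integral_rpow_mul_w0_le_Fz (by norm_num) hx hxX
      have hF3 : (Fz (1 / 3 : ℝ) x).re - (Fz (1 / 3 : ℝ) B).re = ∫ t in x..B, t ^ (1 / 3 : ℝ) * w0 t :=
        Fz_re_sub (by norm_num) hx hxB
      rw [hK, hAB]
      linarith
  have hKlim : Tendsto (fun X : ℝ ↦ (Fz (1 / 2 : ℝ) x).re + 4 / 3 * (Fz (1 / 3 : ℝ) x).re +
      K * X ^ (-(3 / 4) : ℝ)) atTop (𝓝 ((Fz (1 / 2 : ℝ) x).re + 4 / 3 * (Fz (1 / 3 : ℝ) x).re + K * 0)) :=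
    tendsto_const_nhds.add ((tendsto_rpow_neg_atTop (by norm_num : (0 : ℝ) < 3 / 4)).const_mul K)
  rw [mul_zero, add_zero] at hKlim
  exact le_of_tendsto_of_tendsto hlim' hKlim hbound

end NicolasCor21RH

end Literature.NumberTheory.LFunctions

end
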